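import Summits.SmoothPoincare4.SmoothPoincare4.Theses.WeylBudget
import Literature.Geometry.Riemannian.ThreePieceGluedMetric
import Literature.Geometry.Riemannian.CollarGluingPieces
import Literature.Geometry.Riemannian.WarpedSeamMetric
import Literature.Topology.FourManifolds.CollarReparamInPt
import Literature.Geometry.Lorentzian.CurvatureRegularity
import HarnessLib

/-!
# Stub `stub_collarGluing` of line `birth` for the crux `CorkRegluablePsc`
(item stmt-SmoothPoincare4-3206, route WeylBudget)

**The τ-equivariant collar gluing.**  Two Riemannian PSC metrics `g_C` on `C`, `g_W` on `W`
(compact smooth 4-manifolds with boundary data, `φ : ∂C ≅ ∂W`, `τ` an involution of `∂C`) which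
on closed collars `c_C`, `c_W` are the umbilic `C₀`-normal warped products
`ε² ds² + (1 - 2 μ_C(z) ε s - C₀ ε² s²) h_C` resp. `… μ_W … h_W` (`h = incl^* g`), with `μ_C`
smooth and τ-invariant, `μ_W ∘ φ = -μ_C`, `τ^* h_C = h_C`, `h_C = φ^* h_W`, glue on a closed smooth
4-manifold `P = C ∪_φ W` to a Riemannian PSC metric `g` with an open `U ⊇ j_C(∂C)` and a map `T`
smooth, involutive, side-preserving and `g`-isometric on `U`, `T ∘ j_C ∘ incl = j_C ∘ incl ∘ τ`.

Proof (Hirsch 1976, Ch. 8 §2; Milnor 1965, Thm. 1.4; Bär–Hanke 2023, §3, Cor. 34).  Reparametrise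
the collars by `s = tanh t` (`C`) and `s = tanh (-t)` (`W`): this gives long open collars
(`BoundaryData.Collar.exists_openCollar_tanh`) and the three-piece gluing
`P := (C - ∂C) ∪ (∂C × ℝ) ∪ (W - ∂W)` of the tree (`BoundaryGlueData`, pieces `jM`, `jN`).  On the
seam tube `∂C × ℝ` both collar metrics read
`ε² (1 - tanh² t)² dt² + (1 - 2 μ_C(z) ε tanh t - C₀ ε² tanh² t) h_C(z)` — ONE smooth warped metric
`g_S` (`exists_warpedSeamMetric`; positivity of the warping factor: `warpingFactor_pos`), for which
the two gluing maps are isometries (`val_mfderiv_inPt_eq`, `val_mfderiv_inPt_neg_eq`, using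
`μ_W ∘ φ = -μ_C` and `h_C = φ^* h_W`); hence `g_C`, `g_S`, `g_W` descend to a smooth metric `g` on
`P` (`exists_threePieceGluedMetric`) whose scalar curvature is that of `g_C` / `g_W` at interior
points and that of `g_S` on the tube, positive on `t ≠ 0` (interior points again) and at `t = 0`
by continuity of `scal g_S` and compactness of `C`.  `U :=` the tube, `T := τ × id` on it
(`exists_seamInvolution`), an isometry of `g_S` because `μ_C ∘ τ = μ_C` and `τ^* h_C = h_C`
(`warpedSeam_val_prodMap`).  An empty boundary is the disjoint union
(`isBoundaryGluing_interiorSum`, `exists_pscMetric_of_disjoint_pieces`, `U = ∅`, `T = id`).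

The statement is the registered stub, verbatim from the checked skeleton `Lines/birth.lean`
(namespace `Summit.SmoothPoincare4.SmoothPoincare4.Theorems`).  Everything is proved; no
definitions, no named facts.
-/

noncomputable section

-- the prescribed namespace `Summit.<P>.<Sub>.…` duplicates `SmoothPoincare4` (P = Sub)
set_option linter.dupNamespace false

open scoped Manifold ContDiff Topology
open Set Function Filter

namespace Summit.SmoothPoincare4.SmoothPoincare4.Theorems

open Literature.Topology.FourManifolds Literature.Geometry.Lorentzian
  Literature.Geometry.Lorentzian.PseudoRiemannianMetric Literature.Geometry.Riemannian

set_option maxHeartbeats 1600000 in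
/-- **Stub 2B-iii — the τ-equivariant collar gluing (construction).**  Two Riemannian PSC metrics
`gC` on `C`, `gW` on `W` which on collars `cC`, `cW` are the umbilic `C₀`-normal warped products
`ε² ds² + (1 - 2 μ_C(z) ε s - C₀ ε² s²) h_C` resp. `… μ_W … h_W` (`h = incl^* g`), with `μ_C`
smooth and τ-invariant, `μ_W ∘ φ = -μ_C`, `τ^* h_C = h_C` and `h_C = φ^* h_W`, glue on SOME
Hausdorff second-countable smooth closed 4-manifold `P = C ∪_φ W` (explicit piece embeddings
`jC, jW`) to a Riemannian PSC metric `g` with an open `U ⊇ jC(∂C)` and `T : P → P` smooth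
involutive side-preserving and `g`-isometric on `U`, `T ∘ jC ∘ incl = jC ∘ incl ∘ τ`: the
three-piece gluing along the `tanh`-reparametrised collars with the warped seam metric
`ε² (1 - tanh² t)² dt² + (1 - 2μ_C(z) ε tanh t - C₀ ε² tanh² t) h_z` and `T = τ × id` on the tube
(see the module docstring). [cite: HirschDT1976, Ch. 8 §2; BarHanke2023, §3 Cor. 34] -/
theorem stub_collarGluing :
    ∀ (C : Type) [TopologicalSpace C] [T2Space C] [SecondCountableTopology C]
    [ChartedSpace (EuclideanHalfSpace 4) C] [IsManifold (𝓡∂ 4) ∞ C] [CompactSpace C]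
    (bC : Literature.Topology.FourManifolds.BoundaryData (𝓡∂ 4) C (𝓡 3))
    (W : Type) [TopologicalSpace W] [T2Space W] [SecondCountableTopology W]
    [ChartedSpace (EuclideanHalfSpace 4) W] [IsManifold (𝓡∂ 4) ∞ W] [CompactSpace W]
    (bW : Literature.Topology.FourManifolds.BoundaryData (𝓡∂ 4) W (𝓡 3))
    (φ : bC.carrier ≃ₘ⟮𝓡 3, 𝓡 3⟯ bW.carrier) (τ : bC.carrier ≃ₘ⟮𝓡 3, 𝓡 3⟯ bC.carrier),
    Function.Involutive τ →
    ∀ (gC : Literature.Geometry.Lorentzian.PseudoRiemannianMetric (𝓡∂ 4) ∞ (EuclideanSpace ℝ (Fin 4)) (TangentSpace (𝓡∂ 4) : C → Type _)) [gC.HasLeviCivita]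
    (gW : Literature.Geometry.Lorentzian.PseudoRiemannianMetric (𝓡∂ 4) ∞ (EuclideanSpace ℝ (Fin 4)) (TangentSpace (𝓡∂ 4) : W → Type _)) [gW.HasLeviCivita]
    (μC : bC.carrier → ℝ) (μW : bW.carrier → ℝ) (C₀ ε : ℝ) (cC : bC.Collar) (cW : bW.Collar),
    gC.IsRiemannian → (∀ x, 0 < gC.scalarCurvature x) →
    gW.IsRiemannian → (∀ x, 0 < gW.scalarCurvature x) →
    0 < ε → ContMDiff (𝓡 3) 𝓘(ℝ, ℝ) ∞ μC → (∀ z, μC (τ z) = μC z) →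
    (∀ z, μW (φ z) = -μC z) →
    (∀ z, Literature.Geometry.Lorentzian.pullbackBilin (I := 𝓡∂ 4) (I' := 𝓡 3) (bC.incl ∘ τ) gC.val z =
      Literature.Geometry.Lorentzian.pullbackBilin (I := 𝓡∂ 4) (I' := 𝓡 3) bC.incl gC.val z) →
    (∀ z, Literature.Geometry.Lorentzian.pullbackBilin (I := 𝓡∂ 4) (I' := 𝓡 3) bC.incl gC.val z =
      Literature.Geometry.Lorentzian.pullbackBilin (I := 𝓡∂ 4) (I' := 𝓡 3) (bW.incl ∘ φ) gW.val z) →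
    (∀ (p : bC.carrier × Set.Icc (0 : ℝ) 1) (V V' : TangentSpace ((𝓡 3).prod (𝓡∂ 1)) p),
      Literature.Geometry.Lorentzian.pullbackBilin (I := 𝓡∂ 4) (I' := (𝓡 3).prod (𝓡∂ 1)) cC gC.val p V V' =
        ε ^ 2 * ((show EuclideanSpace ℝ (Fin 1) from V.2) 0 *
          (show EuclideanSpace ℝ (Fin 1) from V'.2) 0) +
        (1 - 2 * μC p.1 * (ε * (p.2 : ℝ)) - C₀ * (ε * (p.2 : ℝ)) ^ 2) *
          Literature.Geometry.Lorentzian.pullbackBilin (I := 𝓡∂ 4) (I' := 𝓡 3) bC.incl gC.val p.1 V.1 V'.1) →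
    (∀ (q : bW.carrier × Set.Icc (0 : ℝ) 1) (V V' : TangentSpace ((𝓡 3).prod (𝓡∂ 1)) q),
      Literature.Geometry.Lorentzian.pullbackBilin (I := 𝓡∂ 4) (I' := (𝓡 3).prod (𝓡∂ 1)) cW gW.val q V V' =
        ε ^ 2 * ((show EuclideanSpace ℝ (Fin 1) from V.2) 0 *
          (show EuclideanSpace ℝ (Fin 1) from V'.2) 0) +
        (1 - 2 * μW q.1 * (ε * (q.2 : ℝ)) - C₀ * (ε * (q.2 : ℝ)) ^ 2) *
          Literature.Geometry.Lorentzian.pullbackBilin (I := 𝓡∂ 4) (I' := 𝓡 3) bW.incl gW.val q.1 V.1 V'.1) →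
    ∃ (P : Type) (_ : TopologicalSpace P) (_ : T2Space P) (_ : SecondCountableTopology P)
    (_ : ChartedSpace (EuclideanSpace ℝ (Fin 4)) P) (_ : IsManifold (𝓡 4) ∞ P),
    ∃ (jC : C → P) (jW : W → P),
    (Manifold.IsSmoothEmbedding (𝓡∂ 4) (𝓡 4) ∞ jC ∧ Manifold.IsSmoothEmbedding (𝓡∂ 4) (𝓡 4) ∞ jW ∧
      Set.range jC ∪ Set.range jW = Set.univ ∧
      (∀ a b, jC a = jW b ↔ ∃ z, a = bC.incl z ∧ b = bW.incl (φ z))) ∧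
    ∃ (g : Literature.Geometry.Lorentzian.PseudoRiemannianMetric (𝓡 4) ∞ (EuclideanSpace ℝ (Fin 4)) (TangentSpace (𝓡 4) : P → Type _))
    (U : Set P) (T : P → P),
      g.IsRiemannian ∧ (∃ _ : g.HasLeviCivita, ∀ x, 0 < g.scalarCurvature x) ∧
      IsOpen U ∧ (∀ z, jC (bC.incl z) ∈ U) ∧ ContMDiffOn (𝓡 4) (𝓡 4) ∞ T U ∧
      (∀ x ∈ U, T x ∈ U) ∧ (∀ x ∈ U, T (T x) = x) ∧
      (∀ x ∈ U, (T x ∈ Set.range jC ↔ x ∈ Set.range jC)) ∧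
      (∀ z, T (jC (bC.incl z)) = jC (bC.incl (τ z))) ∧
      (∀ x ∈ U, Literature.Geometry.Lorentzian.pullbackBilin (I := 𝓡 4) (I' := 𝓡 4) T g.val x = g.val x) := by
  intro C _ _ _ _ _ _ bC W _ _ _ _ _ _ bW φ τ hτ gC _ gW _ μC μW C₀ ε cC cW hRC hSC hRW hSW hε hμ hμτ
    hμW hτh hCW hcC hcW
  rcases isEmpty_or_nonempty bC.carrier with hE | hNE
  · ----------------------------------------------------------------------------------------
    -- empty boundary: the disjoint union
    haveI : IsEmpty bW.carrier := φ.toEquiv.symm.isEmpty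
    have hC := bC.isInteriorPoint_of_isEmpty
    have hW := bW.isInteriorPoint_of_isEmpty
    haveI := compactSpace_interiorSum hC hW
    haveI : SecondCountableTopology (InteriorManifold (𝓡∂ 4) (C ⊕ W)) :=
      ChartedSpace.secondCountable_of_sigmaCompact (EuclideanSpace ℝ (Fin 4)) _
    obtain ⟨jC, jW, h1, h2, h3, h4⟩ := isBoundaryGluing_interiorSum (bM := bC) (bN := bW) φ
    have hdisj : ∀ a b, jC a ≠ jW b := fun a b hab ↦ by
      obtain ⟨z, -⟩ := (h4 a b).1 hab
      exact isEmptyElim z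
    obtain ⟨g, hglc, hgR, hgS⟩ :=
      exists_pscMetric_of_disjoint_pieces h1 h2 h3 hdisj gC hRC hSC gW hRW hSW
    refine ⟨InteriorManifold (𝓡∂ 4) (C ⊕ W), inferInstance, inferInstance, inferInstance,
      inferInstance, inferInstance, jC, jW, ⟨h1, h2, h3, h4⟩, g, ∅, id, hgR, ⟨hglc, hgS⟩,
      isOpen_empty, fun z ↦ isEmptyElim z, fun x hx ↦ hx.elim, fun x hx ↦ hx.elim,
      fun x hx ↦ hx.elim, fun x hx ↦ hx.elim, fun z ↦ isEmptyElim z, fun x hx ↦ hx.elim⟩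
  ----------------------------------------------------------------------------------------
  -- nonempty boundary: the three-piece gluing along reparametrised collars
  haveI : Nonempty bW.carrier := ⟨φ (Classical.arbitrary _)⟩
  haveI : Nonempty C := ⟨bC.incl (Classical.arbitrary _)⟩
  haveI : Nonempty W := ⟨bW.incl (Classical.arbitrary _)⟩
  obtain ⟨CM, hCM, -⟩ := cC.exists_openCollar_tanh
  obtain ⟨CN, hCN, -⟩ := cW.exists_openCollar_tanh
  obtain ⟨G, hGM, hGN, hGφ⟩ : ∃ G : BoundaryGlueData bC bW, G.CM = CM ∧ G.CN = CN ∧ G.φ = φ :=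
    ⟨⟨CM, CN, φ⟩, rfl, rfl, rfl⟩
  subst hGM hGN hGφ
  -- the boundary metric `h = incl^* gC`
  have hsp : gC.IsSpacelikeImmersion (𝓡 3) bC.incl :=
    isSpacelikeImmersion_of_isRiemannian hRC bC.isSmoothEmbedding
  set hB := gC.inducedMetric bC.incl contMDiff_pullbackBilin_holds hsp with hhB
  have hBval : hB.val = pullbackBilin (I := 𝓡∂ 4) (I' := 𝓡 3) bC.incl gC.val := rfl
  have hBpos : hB.IsRiemannian := isRiemannian_ofRiemannian _
  -- differentiability bookkeeping
  have hinclC : ∀ z, MDifferentiableAt (𝓡 3) (𝓡∂ 4) bC.incl z := fun z ↦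
    (bC.isSmoothEmbedding.contMDiff z).mdifferentiableAt (by simp)
  have hinclW : ∀ w, MDifferentiableAt (𝓡 3) (𝓡∂ 4) bW.incl w := fun w ↦
    (bW.isSmoothEmbedding.contMDiff w).mdifferentiableAt (by simp)
  have hφmd : ∀ z, MDifferentiableAt (𝓡 3) (𝓡 3) G.φ z := fun z ↦
    (G.φ.contMDiff z).mdifferentiableAt (by simp)
  have hτmd : ∀ z, MDifferentiableAt (𝓡 3) (𝓡 3) τ z := fun z ↦
    (τ.contMDiff z).mdifferentiableAt (by simp)
  -- the warping functions `a = ε² (1 - tanh²)²`, `F = 1 - 2 μ ε tanh - C₀ ε² tanh²`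
  set a : bC.carrier × ℝ → ℝ := fun p ↦ ε ^ 2 * (1 - Real.tanh p.2 ^ 2) ^ 2 with ha_def
  set F : bC.carrier × ℝ → ℝ :=
    fun p ↦ 1 - 2 * μC p.1 * (ε * Real.tanh p.2) - C₀ * (ε * Real.tanh p.2) ^ 2 with hF_def
  have htanh : ContMDiff ((𝓡 3).prod 𝓘(ℝ, ℝ)) 𝓘(ℝ, ℝ) ∞ fun p : bC.carrier × ℝ ↦ Real.tanh p.2 :=
    contDiff_real_tanh.contMDiff.comp contMDiff_snd
  have hμ' : ContMDiff ((𝓡 3).prod 𝓘(ℝ, ℝ)) 𝓘(ℝ, ℝ) ∞ fun p : bC.carrier × ℝ ↦ μC p.1 :=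
    hμ.comp contMDiff_fst
  have ha : ContMDiff ((𝓡 3).prod 𝓘(ℝ, ℝ)) 𝓘(ℝ, ℝ) ∞ a := by
    have h1 : ContDiff ℝ ∞ fun s : ℝ ↦ ε ^ 2 * (1 - s ^ 2) ^ 2 :=
      contDiff_const.mul ((contDiff_const.sub (contDiff_id.pow 2)).pow 2)
    exact h1.contMDiff.comp htanh
  have hF : ContMDiff ((𝓡 3).prod 𝓘(ℝ, ℝ)) 𝓘(ℝ, ℝ) ∞ F := by
    have h1 : ContDiff ℝ ∞ fun ms : ℝ × ℝ ↦
        1 - 2 * ms.1 * (ε * ms.2) - C₀ * (ε * ms.2) ^ 2 :=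
      (contDiff_const.sub ((contDiff_const.mul contDiff_fst).mul
        (contDiff_const.mul contDiff_snd))).sub (contDiff_const.mul
        ((contDiff_const.mul contDiff_snd).pow 2))
    exact h1.contMDiff.comp (hμ'.prodMk_space htanh)
  have ha0 : ∀ p, 0 < a p := fun p ↦ mul_pos (pow_pos hε 2) (pow_pos (one_sub_tanh_sq_pos _) 2)
  have hFCpos := warpingFactor_pos cC gC hRC
    (fun p ↦ 1 - 2 * μC p.1 * (ε * (p.2 : ℝ)) - C₀ * (ε * (p.2 : ℝ)) ^ 2) ε hcC
  have hFWpos := warpingFactor_pos cW gW hRW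
    (fun q ↦ 1 - 2 * μW q.1 * (ε * (q.2 : ℝ)) - C₀ * (ε * (q.2 : ℝ)) ^ 2) ε hcW
  have hF0 : ∀ p, 0 < F p := by
    intro p
    rcases le_or_gt 0 (Real.tanh p.2) with h0 | h0
    · exact hFCpos (p.1, ⟨Real.tanh p.2, h0, (Real.tanh_lt_one _).le⟩)
    · have h := hFWpos (G.φ p.1, ⟨-Real.tanh p.2, by linarith,
        by linarith [Real.neg_one_lt_tanh p.2]⟩)
      have h' : 0 < 1 - 2 * μW (G.φ p.1) * (ε * -Real.tanh p.2) - C₀ * (ε * -Real.tanh p.2) ^ 2 := h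
      rw [hμW] at h'
      show 0 < 1 - 2 * μC p.1 * (ε * Real.tanh p.2) - C₀ * (ε * Real.tanh p.2) ^ 2
      nlinarith [h']
  obtain ⟨gS, hgSr, hgSval⟩ := exists_warpedSeamMetric hB hBpos ha hF ha0 hF0
  haveI hgSlc : gS.HasLeviCivita := gS.hasLeviCivita
  -- the collar of `C` is an isometry on `t > 0`
  have hMiso : ∀ p : bC.carrier × ℝ, 0 < p.2 → ∀ v w : TangentSpace ((𝓡 3).prod 𝓘(ℝ, ℝ)) p,
      gC.val (G.CM.inPt p).val
        (mfderiv ((𝓡 3).prod 𝓘(ℝ, ℝ)) (𝓡∂ 4) (InteriorManifold.val ∘ G.CM.inPt) p v)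
        (mfderiv ((𝓡 3).prod 𝓘(ℝ, ℝ)) (𝓡∂ 4) (InteriorManifold.val ∘ G.CM.inPt) p w) =
      gS.val p v w := by
    intro p hp v w
    have key := val_mfderiv_inPt_eq cC G.CM hCM gC.val
      (fun z ↦ pullbackBilin (I := 𝓡∂ 4) (I' := 𝓡 3) bC.incl gC.val z)
      (fun p ↦ 1 - 2 * μC p.1 * (ε * (p.2 : ℝ)) - C₀ * (ε * (p.2 : ℝ)) ^ 2) ε hcC hp v w
    rw [key, hgSval, Set.projIcc_of_mem zero_le_one (tanh_mem_Icc hp.le)]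
    rw [hBval]
  -- the re-indexed collar of `W` is an isometry on `t < 0`
  have hNiso : ∀ p : bC.carrier × ℝ, p.2 < 0 → ∀ v w : TangentSpace ((𝓡 3).prod 𝓘(ℝ, ℝ)) p,
      gW.val (G.CN.inPt (G.φ p.1, -p.2)).val
        (mfderiv ((𝓡 3).prod 𝓘(ℝ, ℝ)) (𝓡∂ 4)
          (fun q : bC.carrier × ℝ ↦ (G.CN.inPt (G.φ q.1, -q.2)).val) p v)
        (mfderiv ((𝓡 3).prod 𝓘(ℝ, ℝ)) (𝓡∂ 4)
          (fun q : bC.carrier × ℝ ↦ (G.CN.inPt (G.φ q.1, -q.2)).val) p w) =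
      gS.val p v w := by
    intro p hp v w
    have key := val_mfderiv_inPt_neg_eq cW G.CN hCN gW.val
      (fun w ↦ pullbackBilin (I := 𝓡∂ 4) (I' := 𝓡 3) bW.incl gW.val w)
      (fun q ↦ 1 - 2 * μW q.1 * (ε * (q.2 : ℝ)) - C₀ * (ε * (q.2 : ℝ)) ^ 2) ε hcW (hφmd p.1) hp v w
    have hpr : (Set.projIcc (0 : ℝ) 1 zero_le_one (Real.tanh (-p.2)) : ℝ) = -Real.tanh p.2 := by
      rw [Set.projIcc_of_mem zero_le_one (tanh_mem_Icc (by linarith : (0 : ℝ) ≤ -p.2))]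
      exact Real.tanh_neg p.2
    -- `h_W(φ z)(dφ v₁, dφ w₁) = (φ^* h_W)_z(v₁, w₁) = h_C(z)(v₁, w₁)`
    have hh : pullbackBilin (I := 𝓡∂ 4) (I' := 𝓡 3) bW.incl gW.val (G.φ p.1)
        (mfderiv (𝓡 3) (𝓡 3) G.φ p.1 v.1) (mfderiv (𝓡 3) (𝓡 3) G.φ p.1 w.1) =
        hB.val p.1 v.1 w.1 := by
      have h2 : pullbackBilin (I := 𝓡∂ 4) (I' := 𝓡 3) (bW.incl ∘ G.φ) gW.val p.1 v.1 w.1 =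
          pullbackBilin (I := 𝓡∂ 4) (I' := 𝓡 3) bW.incl gW.val (G.φ p.1)
            (mfderiv (𝓡 3) (𝓡 3) G.φ p.1 v.1) (mfderiv (𝓡 3) (𝓡 3) G.φ p.1 w.1) := by
        rw [pullbackBilin_apply, pullbackBilin_apply, mfderiv_comp p.1 (hinclW _) (hφmd p.1)]
        rfl
      rw [← h2, ← hCW p.1, hBval]
    rw [key, hgSval, hpr, hh, hμW]
    simp only [ha_def, hF_def]
    ring
  -- glue the three metrics
  obtain ⟨g, hglc, hgtube, hgR, hgsM, hgsN, hgsS⟩ :=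
    exists_threePieceGluedMetric G gC gW gS hMiso hNiso
  have hgRiem : g.IsRiemannian := hgR hRC hRW hgSr
  -- scalar curvature of the seam metric off `t = 0`
  have hSpos_t : ∀ p : bC.carrier × ℝ, 0 < p.2 →
      gS.scalarCurvature p = gC.scalarCurvature (G.CM.inPt p).val := fun p hp ↦ by
    rw [← hgsS p, G.inl_inl_eq_inl_inr hp, hgsM]
  have hSneg_t : ∀ p : bC.carrier × ℝ, p.2 < 0 →
      gS.scalarCurvature p = gW.scalarCurvature (G.CN.inPt (G.φ p.1, -p.2)).val := fun p hp ↦ by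
    rw [← hgsS p, G.inl_inl_eq_inr_inPt hp, hgsN]
  -- a positive lower bound for `scal gC` on the compact `C`, and `t = 0` by continuity
  obtain ⟨x₀, -, hx₀⟩ := isCompact_univ.exists_isMinOn univ_nonempty
    (gC.contMDiff_scalarCurvature.continuous.continuousOn)
  have hδ : 0 < gC.scalarCurvature x₀ := hSC x₀
  have hδle : ∀ x, gC.scalarCurvature x₀ ≤ gC.scalarCurvature x := fun x ↦
    (isMinOn_iff.1 hx₀) x (mem_univ x)
  have hS0 : ∀ z : bC.carrier, 0 < gS.scalarCurvature (z, 0) := by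
    intro z
    have hcont : Continuous fun t : ℝ ↦ gS.scalarCurvature (z, t) :=
      gS.contMDiff_scalarCurvature.continuous.comp (continuous_const.prodMk continuous_id)
    have htend : Tendsto (fun t : ℝ ↦ gS.scalarCurvature (z, t)) (𝓝[>] 0)
        (𝓝 (gS.scalarCurvature (z, 0))) :=
      (hcont.tendsto 0).mono_left nhdsWithin_le_nhds
    have hev : ∀ᶠ t in 𝓝[>] (0 : ℝ), gC.scalarCurvature x₀ ≤ gS.scalarCurvature (z, t) := by
      filter_upwards [self_mem_nhdsWithin] with t ht
      rw [hSpos_t (z, t) ht]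
      exact hδle _
    exact lt_of_lt_of_le hδ (ge_of_tendsto htend hev)
  have hSall : ∀ p, 0 < gS.scalarCurvature p := by
    rintro ⟨z, t⟩
    rcases lt_trichotomy t 0 with ht | rfl | ht
    · rw [hSneg_t (z, t) ht]
      exact hSW _
    · exact hS0 z
    · rw [hSpos_t (z, t) ht]
      exact hSC _
  have hscal : ∀ x, 0 < g.scalarCurvature x := by
    intro x
    rcases G.exists_tube_or_interior x with ⟨p, rfl⟩ | ⟨a', rfl⟩ | ⟨b', rfl⟩
    · rw [hgsS]
      exact hSall p
    · rw [hgsM]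
      exact hSC _
    · rw [hgsN]
      exact hSW _
  -- the involution `τ × id` of the tube
  obtain ⟨T, hTt, hTs, hTU, hTT, hTside, hTincl⟩ := G.exists_seamInvolution τ hτ
  have htubemd : ∀ p, MDifferentiableAt ((𝓡 3).prod 𝓘(ℝ, ℝ)) (𝓡 4) (G.d₂.inl ∘ G.d₁.inl) p :=
    fun p ↦ (G.contMDiff_inl_inl p).mdifferentiableAt (by simp)
  have hiso : ∀ x ∈ range (G.d₂.inl ∘ G.d₁.inl),
      pullbackBilin (I := 𝓡 4) (I' := 𝓡 4) T g.val x = g.val x := by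
    rintro _ ⟨p, rfl⟩
    ext u u'
    obtain ⟨v, rfl⟩ := (G.bijective_mfderiv_inl_inl p).2 u
    obtain ⟨w, rfl⟩ := (G.bijective_mfderiv_inl_inl p).2 u'
    rw [pullbackBilin_apply]
    have hτ'md : MDifferentiableAt ((𝓡 3).prod 𝓘(ℝ, ℝ)) ((𝓡 3).prod 𝓘(ℝ, ℝ))
        (Prod.map τ id) p := (hτmd p.1).prodMap' mdifferentiableAt_id
    have hTmd : MDifferentiableAt (𝓡 4) (𝓡 4) T ((G.d₂.inl ∘ G.d₁.inl) p) :=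
      (hTs.contMDiffAt (G.isOpen_range_inl_inl.mem_nhds ⟨p, rfl⟩)).mdifferentiableAt (by simp)
    have hfun : T ∘ (G.d₂.inl ∘ G.d₁.inl) = (G.d₂.inl ∘ G.d₁.inl) ∘ Prod.map τ id :=
      funext fun q ↦ hTt q
    have hvec : ∀ u : TangentSpace ((𝓡 3).prod 𝓘(ℝ, ℝ)) p,
        mfderiv (𝓡 4) (𝓡 4) T ((G.d₂.inl ∘ G.d₁.inl) p)
          (mfderiv ((𝓡 3).prod 𝓘(ℝ, ℝ)) (𝓡 4) (G.d₂.inl ∘ G.d₁.inl) p u) =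
        mfderiv ((𝓡 3).prod 𝓘(ℝ, ℝ)) (𝓡 4) (G.d₂.inl ∘ G.d₁.inl) (Prod.map τ id p)
          (mfderiv ((𝓡 3).prod 𝓘(ℝ, ℝ)) ((𝓡 3).prod 𝓘(ℝ, ℝ)) (Prod.map τ id) p u) := fun u ↦ by
      have h1 := mfderiv_comp p hTmd (htubemd p)
      have h2 := mfderiv_comp p (htubemd (Prod.map τ id p)) hτ'md
      rw [hfun] at h1
      exact (DFunLike.congr_fun h1 u).symm.trans (DFunLike.congr_fun h2 u)
    have hpt : T ((G.d₂.inl ∘ G.d₁.inl) p) = (G.d₂.inl ∘ G.d₁.inl) (Prod.map τ id p) := hTt p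
    rw [bilin_congr_point_vec g.val hpt (hvec v) (hvec w)]
    have e1 := hgtube (Prod.map τ id p)
      (mfderiv ((𝓡 3).prod 𝓘(ℝ, ℝ)) ((𝓡 3).prod 𝓘(ℝ, ℝ)) (Prod.map τ id) p v)
      (mfderiv ((𝓡 3).prod 𝓘(ℝ, ℝ)) ((𝓡 3).prod 𝓘(ℝ, ℝ)) (Prod.map τ id) p w)
    have e2 := hgtube p v w
    -- invariance of the seam metric under `τ × id`
    have hh : pullbackBilin (I := 𝓡 3) (I' := 𝓡 3) τ hB.val p.1 = hB.val p.1 := by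
      ext v₁ w₁
      have e : pullbackBilin (I := 𝓡∂ 4) (I' := 𝓡 3) (bC.incl ∘ τ) gC.val p.1 v₁ w₁ =
          pullbackBilin (I := 𝓡∂ 4) (I' := 𝓡 3) bC.incl gC.val (τ p.1)
            (mfderiv (𝓡 3) (𝓡 3) τ p.1 v₁) (mfderiv (𝓡 3) (𝓡 3) τ p.1 w₁) := by
        rw [pullbackBilin_apply, pullbackBilin_apply, mfderiv_comp p.1 (hinclC _) (hτmd p.1)]
        rfl
      rw [pullbackBilin_apply, hBval, ← e, hτh p.1]
    have key := warpedSeam_val_prodMap hgSval (Φ := τ) (p := p) (hτmd p.1) hh rfl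
      (by simp only [hF_def, hμτ]) v w
    rw [pullbackBilin_apply] at key
    exact (e1.trans key).trans e2.symm
  exact ⟨G.d₂.Glued, inferInstance, inferInstance, inferInstance, inferInstance, inferInstance,
    G.jM, G.jN, ⟨G.isSmoothEmbedding_jM, G.isSmoothEmbedding_jN, G.range_jM_union_range_jN,
      fun a' b' ↦ G.jM_eq_jN_iff⟩,
    g, range (G.d₂.inl ∘ G.d₁.inl), T, hgRiem, ⟨hglc, hscal⟩, G.isOpen_range_inl_inl,
    G.jM_incl_mem_range_inl_inl, hTs, hTU, hTT, hTside, hTincl, hiso⟩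

end Summit.SmoothPoincare4.SmoothPoincare4.Theorems
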